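import Literature.Geometry.Lorentzian.FinalEraPackage2
import Summits.FinalStateConjecture.FinalStateConjecture.Statement
import HarnessLib

/-!
# Stub `stub_dispersingCapture` (S6) of line `dilated-leaves-virial-certificate` of crux `Capture`
# (stmt-FinalStateConjecture-10115) IS item `DispersingCapture` (stmt-FinalStateConjecture-10994)

The line `dilated-leaves-virial-certificate` of the crux `Capture` (routes `BartnikGapSettling` /
`QuietWindowCapture`, summit `FinalStateConjecture`; skeleton
`Cruxes/Capture/Lines/dilated_leaves_virial_certificate.lean` of this summit's directory
`Summits/FinalStateConjecture/FinalStateConjecture/`) cuts the crux into six registered stubs; the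
last one, **S6 `stub_dispersingCapture`** — a rev-2 final era
`p : FinalEraPackage₂ 𝒟.toCauchyDevelopment` of an MGHD of an admissible datum with complete `𝓘⁺`
whose labels pairwise disperse in the flat chart (`‖p.ξ i t − p.ξ j t‖ → ∞`, `i ≠ j`) settles
exactly as the Statement demands — is, by the planner's design, the EXISTING open item
`DispersingCapture` of the route `DissipativeFinalMotions` (stmt-FinalStateConjecture-10994,
difficulty XL: Cesàro velocities and Kerr capture of receding holes), restated over the bundled
structure `FinalEraPackage₂` (`Literature/Geometry/Lorentzian/FinalEraPackage2.lean`) instead of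
the item's 18 binders and 31 inline clauses.

This file is the kernel-checked certificate of that identification, free of the route files (the
item's body is inlined verbatim as a hypothesis / conclusion; it `δ`-unfolds to the `Theses` decl
`Summit.FinalStateConjecture.FinalStateConjecture.Theses.DissipativeFinalMotions.DispersingCapture`,
`Iff.rfl`), so that the lead can record S6 as `blocked-on: stmt-FinalStateConjecture-10994` and, the
day that item closes, close S6 by `stub_dispersingCapture_of_dispersingCapture`:

* `stub_dispersingCapture_of_dispersingCapture` — item ⇒ stub: feed the item the 18 data fields of
  `p` and `p.isFinalEra₂ : 𝒟.IsFinalEra₂ p.N … p.O` (bundled ⇒ inline; the 31 clauses of the item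
  ARE `CauchyDevelopment.IsFinalEra₂`, whose clause (O) is the body of
  `Summit.FinalStateConjecture.exteriorOf`, definitionally);
* `dispersingCapture_of_stub_dispersingCapture` — stub ⇒ item: package an inline tuple by
  `FinalEraPackage₂.ofIsFinalEra₂` (its data projections reduce by `rfl`, so the dispersal
  hypothesis and the conclusion are untouched);
* `stub_dispersingCapture_iff_dispersingCapture` — the equivalence.

No definitions, no named facts, no content: pure repackaging (structure eta / `δ`-unfolding).

References: Dafermos–Luk arXiv:1710.01722, p. 8 and Conjecture 1 (the final-state picture the
package records; no printed formulation of either statement exists).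
-/

-- the doubled `FinalStateConjecture.FinalStateConjecture` path component trips dupNamespace
set_option linter.dupNamespace false

noncomputable section

namespace Summit.FinalStateConjecture.FinalStateConjecture.Theorems.BartnikGapSettling.Capture

open Set Filter Function Topology TopologicalSpace MeasureTheory
open scoped Manifold ContDiff ENNReal BigOperators
open Literature.Geometry.Lorentzian

/-- **Item ⇒ stub S6.** The item `DispersingCapture` of route `DissipativeFinalMotions`
(stmt-FinalStateConjecture-10994; its body is the hypothesis, inlined verbatim: for an MGHD of an
admissible datum with complete `𝓘⁺`, every tuple of the 18 final-era binders satisfying the 31 rev-2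
clauses whose worldlines pairwise disperse yields a `C²` `FinalStateDecomposition` of the
self-determined exterior with sub-extremal holes and exhaustive charts) implies the registered stub
`stub_dispersingCapture` of line `dilated-leaves-virial-certificate` (crux `Capture`,
stmt-FinalStateConjecture-10115), verbatim the conclusion: apply the item to the data of the package
`p` and to `p.isFinalEra₂` (the 31 clauses are `CauchyDevelopment.IsFinalEra₂ …`, clause (O) being
the body of `Summit.FinalStateConjecture.exteriorOf`, definitionally). [folklore] -/
theorem stub_dispersingCapture_of_dispersingCapture :
    (∀ (X : Type) [TopologicalSpace X] [ChartedSpace (EuclideanSpace ℝ (Fin 3)) X]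
        [IsManifold (𝓡 3) ((⊤ : ℕ∞) : WithTop ℕ∞) X] [T2Space X] [SecondCountableTopology X]
        [ConnectedSpace X], ∀ (D : Literature.Geometry.Lorentzian.InitialDataSet (𝓡 3) X),
        D ∈ Literature.Geometry.Lorentzian.admissibleVacuumData X →
        ∀ (𝒟 : Literature.Geometry.Lorentzian.VacuumCauchyDevelopment D), 𝒟.IsMaximal →
        Summit.FinalStateConjecture.HasCompleteNullInfinity 𝒟.toCauchyDevelopment →
        ∀ (N : ℕ) (M a : Fin N → ℝ) (T δ V C₁ C₂ ρ₀ κ : ℝ)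
          (ξ : Fin N → ℝ → EuclideanSpace ℝ (Fin 3)) (β : ℝ → ℝ)
          (U₀ : Opens Literature.Geometry.Lorentzian.E4)
          (B₀ : Literature.Geometry.Lorentzian.ModelBackground)
          (B : Fin N → Literature.Geometry.Lorentzian.ModelBackground) (Ψ₀ : B₀.domain → 𝒟.carrier)
          (Ψ : (i : Fin N) → (B i).domain → 𝒟.carrier) (O : Set 𝒟.carrier),
        O = Summit.FinalStateConjecture.exteriorOf 𝒟.toCauchyDevelopment
            (Ψ₀ '' B₀.lateRegion T ∪ ⋃ i, Ψ i '' (B i).lateRegion T) ∧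
        B₀ = Literature.Geometry.Lorentzian.Minkowski.backgroundOn U₀ ∧
        (B = fun i ↦ Literature.Geometry.Lorentzian.Kerr.background (M i) (a i)) ∧
        (∀ i, Literature.Geometry.Lorentzian.Kerr.IsSubextremal (M i) (a i)) ∧ 0 < δ ∧ 0 ≤ V ∧
        V < 1 ∧ 0 ≤ C₁ ∧ 1 ≤ C₂ ∧ 0 < ρ₀ ∧ 0 ≤ κ ∧ (∀ i, ContDiff ℝ 2 (ξ i)) ∧
        (∀ t, T ≤ t → ∀ i j, i ≠ j → δ ≤ ‖ξ i t - ξ j t‖) ∧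
        (∀ i s t, T ≤ s → s ≤ t → ‖ξ i t - ξ i s‖ ≤ V * (t - s)) ∧ IntegrableOn β (Ici T) ∧
        (∀ t, T ≤ t → 0 ≤ β t) ∧
        (∀ t, T ≤ t → ∀ i, ‖deriv (deriv (ξ i)) t +
            ∑ j ∈ Finset.univ.erase i, (M j / ‖ξ i t - ξ j t‖ ^ 3) • (ξ i t - ξ j t)‖ ≤
          κ * (∑ j ∈ Finset.univ.erase i, M j / ‖ξ i t - ξ j t‖ ^ 2 *
            (‖deriv (ξ i) t‖ ^ 2 + ‖deriv (ξ j) t‖ ^ 2 + (∑ l, M l) / ‖ξ i t - ξ j t‖)) + β t) ∧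
        𝒟.toSpacetime.IsLateChart B₀ O T Ψ₀ ∧
        {y : Literature.Geometry.Lorentzian.E4 | T < y 0 ∧
            ∀ i, ρ₀ < ‖Literature.Geometry.Lorentzian.E4.spatial y - ξ i (y 0)‖} ⊆
          (B₀.domain : Set Literature.Geometry.Lorentzian.E4) ∧
        (∀ ε : ℝ, 0 < ε → ∃ ϱ T' : ℝ, ∀ τ, T' ≤ τ →
          Literature.Geometry.Lorentzian.supCkENorm
              (Subtype.val '' {y : B₀.domain | y.1 0 = τ ∧
                ∀ i, ϱ ≤ ‖Literature.Geometry.Lorentzian.E4.spatial y.1 - ξ i τ‖})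
              2 (𝒟.toSpacetime.deviationExtend B₀ Ψ₀) ≤ ENNReal.ofReal ε) ∧
        (∀ i, 𝒟.toSpacetime.IsLateChart (B i) O T (Ψ i)) ∧
        (∀ i (m : ℕ) (x : (B i).domain), m ≤ 2 → T ≤ x.1 0 → (B i).radius x.1 ≤ 2 * ρ₀ →
          ‖iteratedFDeriv ℝ m (𝒟.toSpacetime.deviationExtend (B i) (Ψ i)) x.1‖ ≤
            1 / (100 * M i ^ m)) ∧
        (∀ i (R ε : ℝ), 0 < ε → ∃ D' : ℝ, ∀ T' : ℝ,
          (∀ t, T' ≤ t → ∀ j, j ≠ i → D' ≤ ‖ξ i t - ξ j t‖) → ∃ T'' : ℝ, ∀ τ, T'' ≤ τ →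
            𝒟.toSpacetime.truncDeviationCk (B i) (Ψ i) 2 R τ ≤ ENNReal.ofReal ε) ∧
        (∀ i j, i ≠ j → Ψ i '' (B i).lateRegion T ∩ Ψ j '' (B j).lateRegion T ⊆ range Ψ₀) ∧
        (∀ i (x : (B i).domain) (y : B₀.domain), T < x.1 0 → Ψ i x = Ψ₀ y →
          ‖Literature.Geometry.Lorentzian.E4.spatial y.1 - ξ i (y.1 0)‖ ≤
            C₂ * (B i).radius x.1 + C₁) ∧
        (∀ i (R : ℝ), ∃ T₃ : ℝ, ∀ y : B₀.domain, T₃ < y.1 0 →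
          ‖Literature.Geometry.Lorentzian.E4.spatial y.1 - ξ i (y.1 0)‖ ≤ R →
            ∃ x : (B i).domain, Ψ i x = Ψ₀ y ∧ T < x.1 0 ∧ (B i).radius x.1 ≤ C₂ * R + C₁) ∧
        (∀ i (t₀ : ℝ), ∃ τ' : ℝ,
          Ψ i '' (B i).lateRegion τ' ∩ Ψ₀ '' {y : B₀.domain | y.1 0 ≤ t₀} = ∅) ∧
        (∀ i (τ' R : ℝ), ∃ t₀ : ℝ, Ψ₀ '' {y : B₀.domain | t₀ < y.1 0} ∩
          Ψ i '' {x : (B i).domain | x.1 0 ≤ τ' ∧ (B i).radius x.1 ≤ R} = ∅) ∧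
        (∀ τ₁, T < τ₁ →
          O \ (Ψ₀ '' B₀.lateRegion τ₁ ∪ ⋃ i, Ψ i '' (B i).truncLateRegion τ₁ (2 * ρ₀)) ⊆
            𝒟.toSpacetime.metric.causalPast 𝒟.toSpacetime.timeOrientation
              (Ψ₀ '' B₀.timeSlab τ₁ ∪ ⋃ i, Ψ i '' (B i).truncTimeSlab (2 * ρ₀) τ₁)) ∧
        Pairwise (Disjoint on fun i ↦ Ψ i '' (B i).truncLateRegion T (2 * ρ₀)) ∧
        (∀ i, Literature.Geometry.Lorentzian.Kerr.rPlus (M i) (a i) < ρ₀) →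
        (∀ i j, i ≠ j → Tendsto (fun t ↦ ‖ξ i t - ξ j t‖) atTop atTop) →
        ∃ (O' : Set 𝒟.carrier)
          (d : Literature.Geometry.Lorentzian.FinalStateDecomposition 𝒟.toSpacetime O' 2),
          (∀ i, Literature.Geometry.Lorentzian.Kerr.IsSubextremal (d.mass i) (d.spin i)) ∧
            O' = Summit.FinalStateConjecture.exteriorOf 𝒟.toCauchyDevelopment d.charted ∧
              Summit.FinalStateConjecture.HasExhaustiveCharts d) →
    ∀ (X : Type) [TopologicalSpace X] [ChartedSpace E3 X] [IsManifold (𝓡 3) ∞ X] [T2Space X]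
      [SecondCountableTopology X] [ConnectedSpace X],
      ∀ D ∈ admissibleVacuumData X, ∀ 𝒟 : VacuumCauchyDevelopment D, 𝒟.IsMaximal →
        Summit.FinalStateConjecture.HasCompleteNullInfinity 𝒟.toCauchyDevelopment →
          ∀ p : FinalEraPackage₂ 𝒟.toCauchyDevelopment,
            (∀ i j, i ≠ j → Tendsto (fun t ↦ ‖p.ξ i t - p.ξ j t‖) atTop atTop) →
              ∃ (O : Set 𝒟.carrier) (d : FinalStateDecomposition 𝒟.toSpacetime O 2),
                (∀ i, Kerr.IsSubextremal (d.mass i) (d.spin i)) ∧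
                  O = Summit.FinalStateConjecture.exteriorOf 𝒟.toCauchyDevelopment d.charted ∧
                    Summit.FinalStateConjecture.HasExhaustiveCharts d := by
  intro h X _ _ _ _ _ _ D hD 𝒟 hmax hCNI p hdisp
  exact h X D hD 𝒟 hmax hCNI p.N p.M p.a p.T p.δ p.V p.C₁ p.C₂ p.ρ₀ p.κ p.ξ p.β p.U₀ p.B₀ p.B
    p.Ψ₀ p.Ψ p.O p.isFinalEra₂ hdisp

/-- **Stub S6 ⇒ item.** Conversely, the registered stub `stub_dispersingCapture` (hypothesis,
verbatim) implies the item `DispersingCapture` of route `DissipativeFinalMotions`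
(stmt-FinalStateConjecture-10994; conclusion, its body inlined verbatim): package the inline tuple
by `FinalEraPackage₂.ofIsFinalEra₂` — its data projections reduce by `rfl`, so the dispersal
hypothesis and the settling conclusion are passed through unchanged. [folklore] -/
theorem dispersingCapture_of_stub_dispersingCapture :
    (∀ (X : Type) [TopologicalSpace X] [ChartedSpace E3 X] [IsManifold (𝓡 3) ∞ X] [T2Space X]
        [SecondCountableTopology X] [ConnectedSpace X],
        ∀ D ∈ admissibleVacuumData X, ∀ 𝒟 : VacuumCauchyDevelopment D, 𝒟.IsMaximal →
          Summit.FinalStateConjecture.HasCompleteNullInfinity 𝒟.toCauchyDevelopment →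
            ∀ p : FinalEraPackage₂ 𝒟.toCauchyDevelopment,
              (∀ i j, i ≠ j → Tendsto (fun t ↦ ‖p.ξ i t - p.ξ j t‖) atTop atTop) →
                ∃ (O : Set 𝒟.carrier) (d : FinalStateDecomposition 𝒟.toSpacetime O 2),
                  (∀ i, Kerr.IsSubextremal (d.mass i) (d.spin i)) ∧
                    O = Summit.FinalStateConjecture.exteriorOf 𝒟.toCauchyDevelopment d.charted ∧
                      Summit.FinalStateConjecture.HasExhaustiveCharts d) →
    ∀ (X : Type) [TopologicalSpace X] [ChartedSpace (EuclideanSpace ℝ (Fin 3)) X]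
      [IsManifold (𝓡 3) ((⊤ : ℕ∞) : WithTop ℕ∞) X] [T2Space X] [SecondCountableTopology X]
      [ConnectedSpace X], ∀ (D : Literature.Geometry.Lorentzian.InitialDataSet (𝓡 3) X),
      D ∈ Literature.Geometry.Lorentzian.admissibleVacuumData X →
      ∀ (𝒟 : Literature.Geometry.Lorentzian.VacuumCauchyDevelopment D), 𝒟.IsMaximal →
      Summit.FinalStateConjecture.HasCompleteNullInfinity 𝒟.toCauchyDevelopment →
      ∀ (N : ℕ) (M a : Fin N → ℝ) (T δ V C₁ C₂ ρ₀ κ : ℝ)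
        (ξ : Fin N → ℝ → EuclideanSpace ℝ (Fin 3)) (β : ℝ → ℝ)
        (U₀ : Opens Literature.Geometry.Lorentzian.E4)
        (B₀ : Literature.Geometry.Lorentzian.ModelBackground)
        (B : Fin N → Literature.Geometry.Lorentzian.ModelBackground) (Ψ₀ : B₀.domain → 𝒟.carrier)
        (Ψ : (i : Fin N) → (B i).domain → 𝒟.carrier) (O : Set 𝒟.carrier),
      O = Summit.FinalStateConjecture.exteriorOf 𝒟.toCauchyDevelopment
          (Ψ₀ '' B₀.lateRegion T ∪ ⋃ i, Ψ i '' (B i).lateRegion T) ∧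
      B₀ = Literature.Geometry.Lorentzian.Minkowski.backgroundOn U₀ ∧
      (B = fun i ↦ Literature.Geometry.Lorentzian.Kerr.background (M i) (a i)) ∧
      (∀ i, Literature.Geometry.Lorentzian.Kerr.IsSubextremal (M i) (a i)) ∧ 0 < δ ∧ 0 ≤ V ∧
      V < 1 ∧ 0 ≤ C₁ ∧ 1 ≤ C₂ ∧ 0 < ρ₀ ∧ 0 ≤ κ ∧ (∀ i, ContDiff ℝ 2 (ξ i)) ∧
      (∀ t, T ≤ t → ∀ i j, i ≠ j → δ ≤ ‖ξ i t - ξ j t‖) ∧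
      (∀ i s t, T ≤ s → s ≤ t → ‖ξ i t - ξ i s‖ ≤ V * (t - s)) ∧ IntegrableOn β (Ici T) ∧
      (∀ t, T ≤ t → 0 ≤ β t) ∧
      (∀ t, T ≤ t → ∀ i, ‖deriv (deriv (ξ i)) t +
          ∑ j ∈ Finset.univ.erase i, (M j / ‖ξ i t - ξ j t‖ ^ 3) • (ξ i t - ξ j t)‖ ≤
        κ * (∑ j ∈ Finset.univ.erase i, M j / ‖ξ i t - ξ j t‖ ^ 2 *
          (‖deriv (ξ i) t‖ ^ 2 + ‖deriv (ξ j) t‖ ^ 2 + (∑ l, M l) / ‖ξ i t - ξ j t‖)) + β t) ∧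
      𝒟.toSpacetime.IsLateChart B₀ O T Ψ₀ ∧
      {y : Literature.Geometry.Lorentzian.E4 | T < y 0 ∧
          ∀ i, ρ₀ < ‖Literature.Geometry.Lorentzian.E4.spatial y - ξ i (y 0)‖} ⊆
        (B₀.domain : Set Literature.Geometry.Lorentzian.E4) ∧
      (∀ ε : ℝ, 0 < ε → ∃ ϱ T' : ℝ, ∀ τ, T' ≤ τ →
        Literature.Geometry.Lorentzian.supCkENorm
            (Subtype.val '' {y : B₀.domain | y.1 0 = τ ∧
              ∀ i, ϱ ≤ ‖Literature.Geometry.Lorentzian.E4.spatial y.1 - ξ i τ‖})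
            2 (𝒟.toSpacetime.deviationExtend B₀ Ψ₀) ≤ ENNReal.ofReal ε) ∧
      (∀ i, 𝒟.toSpacetime.IsLateChart (B i) O T (Ψ i)) ∧
      (∀ i (m : ℕ) (x : (B i).domain), m ≤ 2 → T ≤ x.1 0 → (B i).radius x.1 ≤ 2 * ρ₀ →
        ‖iteratedFDeriv ℝ m (𝒟.toSpacetime.deviationExtend (B i) (Ψ i)) x.1‖ ≤
          1 / (100 * M i ^ m)) ∧
      (∀ i (R ε : ℝ), 0 < ε → ∃ D' : ℝ, ∀ T' : ℝ,
        (∀ t, T' ≤ t → ∀ j, j ≠ i → D' ≤ ‖ξ i t - ξ j t‖) → ∃ T'' : ℝ, ∀ τ, T'' ≤ τ →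
          𝒟.toSpacetime.truncDeviationCk (B i) (Ψ i) 2 R τ ≤ ENNReal.ofReal ε) ∧
      (∀ i j, i ≠ j → Ψ i '' (B i).lateRegion T ∩ Ψ j '' (B j).lateRegion T ⊆ range Ψ₀) ∧
      (∀ i (x : (B i).domain) (y : B₀.domain), T < x.1 0 → Ψ i x = Ψ₀ y →
        ‖Literature.Geometry.Lorentzian.E4.spatial y.1 - ξ i (y.1 0)‖ ≤
          C₂ * (B i).radius x.1 + C₁) ∧
      (∀ i (R : ℝ), ∃ T₃ : ℝ, ∀ y : B₀.domain, T₃ < y.1 0 →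
        ‖Literature.Geometry.Lorentzian.E4.spatial y.1 - ξ i (y.1 0)‖ ≤ R →
          ∃ x : (B i).domain, Ψ i x = Ψ₀ y ∧ T < x.1 0 ∧ (B i).radius x.1 ≤ C₂ * R + C₁) ∧
      (∀ i (t₀ : ℝ), ∃ τ' : ℝ,
        Ψ i '' (B i).lateRegion τ' ∩ Ψ₀ '' {y : B₀.domain | y.1 0 ≤ t₀} = ∅) ∧
      (∀ i (τ' R : ℝ), ∃ t₀ : ℝ, Ψ₀ '' {y : B₀.domain | t₀ < y.1 0} ∩
        Ψ i '' {x : (B i).domain | x.1 0 ≤ τ' ∧ (B i).radius x.1 ≤ R} = ∅) ∧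
      (∀ τ₁, T < τ₁ →
        O \ (Ψ₀ '' B₀.lateRegion τ₁ ∪ ⋃ i, Ψ i '' (B i).truncLateRegion τ₁ (2 * ρ₀)) ⊆
          𝒟.toSpacetime.metric.causalPast 𝒟.toSpacetime.timeOrientation
            (Ψ₀ '' B₀.timeSlab τ₁ ∪ ⋃ i, Ψ i '' (B i).truncTimeSlab (2 * ρ₀) τ₁)) ∧
      Pairwise (Disjoint on fun i ↦ Ψ i '' (B i).truncLateRegion T (2 * ρ₀)) ∧
      (∀ i, Literature.Geometry.Lorentzian.Kerr.rPlus (M i) (a i) < ρ₀) →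
      (∀ i j, i ≠ j → Tendsto (fun t ↦ ‖ξ i t - ξ j t‖) atTop atTop) →
      ∃ (O' : Set 𝒟.carrier)
        (d : Literature.Geometry.Lorentzian.FinalStateDecomposition 𝒟.toSpacetime O' 2),
        (∀ i, Literature.Geometry.Lorentzian.Kerr.IsSubextremal (d.mass i) (d.spin i)) ∧
          O' = Summit.FinalStateConjecture.exteriorOf 𝒟.toCauchyDevelopment d.charted ∧
            Summit.FinalStateConjecture.HasExhaustiveCharts d := by
  intro h X _ _ _ _ _ _ D hD 𝒟 hmax hCNI _ _ _ _ _ _ _ _ _ _ _ _ _ _ _ _ _ _ hera hdisp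
  exact h X D hD 𝒟 hmax hCNI (FinalEraPackage₂.ofIsFinalEra₂ hera) hdisp

/-- **Stub S6 of line `dilated-leaves-virial-certificate` (crux `Capture`,
stmt-FinalStateConjecture-10115) IS item `DispersingCapture` (stmt-FinalStateConjecture-10994) in
package form**: the registered stub `stub_dispersingCapture` (left, verbatim) is equivalent to the
body (right, inlined verbatim) of
`Summit.FinalStateConjecture.FinalStateConjecture.Theses.DissipativeFinalMotions.DispersingCapture`.
Pure repackaging through the dictionary `FinalEraPackage₂.isFinalEra₂` /
`FinalEraPackage₂.ofIsFinalEra₂`. [folklore] -/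
theorem stub_dispersingCapture_iff_dispersingCapture :
    (∀ (X : Type) [TopologicalSpace X] [ChartedSpace E3 X] [IsManifold (𝓡 3) ∞ X] [T2Space X]
        [SecondCountableTopology X] [ConnectedSpace X],
        ∀ D ∈ admissibleVacuumData X, ∀ 𝒟 : VacuumCauchyDevelopment D, 𝒟.IsMaximal →
          Summit.FinalStateConjecture.HasCompleteNullInfinity 𝒟.toCauchyDevelopment →
            ∀ p : FinalEraPackage₂ 𝒟.toCauchyDevelopment,
              (∀ i j, i ≠ j → Tendsto (fun t ↦ ‖p.ξ i t - p.ξ j t‖) atTop atTop) →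
                ∃ (O : Set 𝒟.carrier) (d : FinalStateDecomposition 𝒟.toSpacetime O 2),
                  (∀ i, Kerr.IsSubextremal (d.mass i) (d.spin i)) ∧
                    O = Summit.FinalStateConjecture.exteriorOf 𝒟.toCauchyDevelopment d.charted ∧
                      Summit.FinalStateConjecture.HasExhaustiveCharts d) ↔
    (∀ (X : Type) [TopologicalSpace X] [ChartedSpace (EuclideanSpace ℝ (Fin 3)) X]
        [IsManifold (𝓡 3) ((⊤ : ℕ∞) : WithTop ℕ∞) X] [T2Space X] [SecondCountableTopology X]
        [ConnectedSpace X], ∀ (D : Literature.Geometry.Lorentzian.InitialDataSet (𝓡 3) X),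
        D ∈ Literature.Geometry.Lorentzian.admissibleVacuumData X →
        ∀ (𝒟 : Literature.Geometry.Lorentzian.VacuumCauchyDevelopment D), 𝒟.IsMaximal →
        Summit.FinalStateConjecture.HasCompleteNullInfinity 𝒟.toCauchyDevelopment →
        ∀ (N : ℕ) (M a : Fin N → ℝ) (T δ V C₁ C₂ ρ₀ κ : ℝ)
          (ξ : Fin N → ℝ → EuclideanSpace ℝ (Fin 3)) (β : ℝ → ℝ)
          (U₀ : Opens Literature.Geometry.Lorentzian.E4)
          (B₀ : Literature.Geometry.Lorentzian.ModelBackground)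
          (B : Fin N → Literature.Geometry.Lorentzian.ModelBackground) (Ψ₀ : B₀.domain → 𝒟.carrier)
          (Ψ : (i : Fin N) → (B i).domain → 𝒟.carrier) (O : Set 𝒟.carrier),
        O = Summit.FinalStateConjecture.exteriorOf 𝒟.toCauchyDevelopment
            (Ψ₀ '' B₀.lateRegion T ∪ ⋃ i, Ψ i '' (B i).lateRegion T) ∧
        B₀ = Literature.Geometry.Lorentzian.Minkowski.backgroundOn U₀ ∧
        (B = fun i ↦ Literature.Geometry.Lorentzian.Kerr.background (M i) (a i)) ∧
        (∀ i, Literature.Geometry.Lorentzian.Kerr.IsSubextremal (M i) (a i)) ∧ 0 < δ ∧ 0 ≤ V ∧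
        V < 1 ∧ 0 ≤ C₁ ∧ 1 ≤ C₂ ∧ 0 < ρ₀ ∧ 0 ≤ κ ∧ (∀ i, ContDiff ℝ 2 (ξ i)) ∧
        (∀ t, T ≤ t → ∀ i j, i ≠ j → δ ≤ ‖ξ i t - ξ j t‖) ∧
        (∀ i s t, T ≤ s → s ≤ t → ‖ξ i t - ξ i s‖ ≤ V * (t - s)) ∧ IntegrableOn β (Ici T) ∧
        (∀ t, T ≤ t → 0 ≤ β t) ∧
        (∀ t, T ≤ t → ∀ i, ‖deriv (deriv (ξ i)) t +
            ∑ j ∈ Finset.univ.erase i, (M j / ‖ξ i t - ξ j t‖ ^ 3) • (ξ i t - ξ j t)‖ ≤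
          κ * (∑ j ∈ Finset.univ.erase i, M j / ‖ξ i t - ξ j t‖ ^ 2 *
            (‖deriv (ξ i) t‖ ^ 2 + ‖deriv (ξ j) t‖ ^ 2 + (∑ l, M l) / ‖ξ i t - ξ j t‖)) + β t) ∧
        𝒟.toSpacetime.IsLateChart B₀ O T Ψ₀ ∧
        {y : Literature.Geometry.Lorentzian.E4 | T < y 0 ∧
            ∀ i, ρ₀ < ‖Literature.Geometry.Lorentzian.E4.spatial y - ξ i (y 0)‖} ⊆
          (B₀.domain : Set Literature.Geometry.Lorentzian.E4) ∧
        (∀ ε : ℝ, 0 < ε → ∃ ϱ T' : ℝ, ∀ τ, T' ≤ τ →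
          Literature.Geometry.Lorentzian.supCkENorm
              (Subtype.val '' {y : B₀.domain | y.1 0 = τ ∧
                ∀ i, ϱ ≤ ‖Literature.Geometry.Lorentzian.E4.spatial y.1 - ξ i τ‖})
              2 (𝒟.toSpacetime.deviationExtend B₀ Ψ₀) ≤ ENNReal.ofReal ε) ∧
        (∀ i, 𝒟.toSpacetime.IsLateChart (B i) O T (Ψ i)) ∧
        (∀ i (m : ℕ) (x : (B i).domain), m ≤ 2 → T ≤ x.1 0 → (B i).radius x.1 ≤ 2 * ρ₀ →
          ‖iteratedFDeriv ℝ m (𝒟.toSpacetime.deviationExtend (B i) (Ψ i)) x.1‖ ≤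
            1 / (100 * M i ^ m)) ∧
        (∀ i (R ε : ℝ), 0 < ε → ∃ D' : ℝ, ∀ T' : ℝ,
          (∀ t, T' ≤ t → ∀ j, j ≠ i → D' ≤ ‖ξ i t - ξ j t‖) → ∃ T'' : ℝ, ∀ τ, T'' ≤ τ →
            𝒟.toSpacetime.truncDeviationCk (B i) (Ψ i) 2 R τ ≤ ENNReal.ofReal ε) ∧
        (∀ i j, i ≠ j → Ψ i '' (B i).lateRegion T ∩ Ψ j '' (B j).lateRegion T ⊆ range Ψ₀) ∧
        (∀ i (x : (B i).domain) (y : B₀.domain), T < x.1 0 → Ψ i x = Ψ₀ y →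
          ‖Literature.Geometry.Lorentzian.E4.spatial y.1 - ξ i (y.1 0)‖ ≤
            C₂ * (B i).radius x.1 + C₁) ∧
        (∀ i (R : ℝ), ∃ T₃ : ℝ, ∀ y : B₀.domain, T₃ < y.1 0 →
          ‖Literature.Geometry.Lorentzian.E4.spatial y.1 - ξ i (y.1 0)‖ ≤ R →
            ∃ x : (B i).domain, Ψ i x = Ψ₀ y ∧ T < x.1 0 ∧ (B i).radius x.1 ≤ C₂ * R + C₁) ∧
        (∀ i (t₀ : ℝ), ∃ τ' : ℝ,
          Ψ i '' (B i).lateRegion τ' ∩ Ψ₀ '' {y : B₀.domain | y.1 0 ≤ t₀} = ∅) ∧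
        (∀ i (τ' R : ℝ), ∃ t₀ : ℝ, Ψ₀ '' {y : B₀.domain | t₀ < y.1 0} ∩
          Ψ i '' {x : (B i).domain | x.1 0 ≤ τ' ∧ (B i).radius x.1 ≤ R} = ∅) ∧
        (∀ τ₁, T < τ₁ →
          O \ (Ψ₀ '' B₀.lateRegion τ₁ ∪ ⋃ i, Ψ i '' (B i).truncLateRegion τ₁ (2 * ρ₀)) ⊆
            𝒟.toSpacetime.metric.causalPast 𝒟.toSpacetime.timeOrientation
              (Ψ₀ '' B₀.timeSlab τ₁ ∪ ⋃ i, Ψ i '' (B i).truncTimeSlab (2 * ρ₀) τ₁)) ∧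
        Pairwise (Disjoint on fun i ↦ Ψ i '' (B i).truncLateRegion T (2 * ρ₀)) ∧
        (∀ i, Literature.Geometry.Lorentzian.Kerr.rPlus (M i) (a i) < ρ₀) →
        (∀ i j, i ≠ j → Tendsto (fun t ↦ ‖ξ i t - ξ j t‖) atTop atTop) →
        ∃ (O' : Set 𝒟.carrier)
          (d : Literature.Geometry.Lorentzian.FinalStateDecomposition 𝒟.toSpacetime O' 2),
          (∀ i, Literature.Geometry.Lorentzian.Kerr.IsSubextremal (d.mass i) (d.spin i)) ∧
            O' = Summit.FinalStateConjecture.exteriorOf 𝒟.toCauchyDevelopment d.charted ∧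
              Summit.FinalStateConjecture.HasExhaustiveCharts d) :=
  ⟨dispersingCapture_of_stub_dispersingCapture, stub_dispersingCapture_of_dispersingCapture⟩

end Summit.FinalStateConjecture.FinalStateConjecture.Theorems.BartnikGapSettling.Capture
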